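import Summits.HodgeConjecture.HodgeConjecture.Theorems.PadicSemiregularLiftFormalVectorBundlesAlgebraize
import Literature.AlgebraicGeometry.Modules.KilledByTransfer
import Literature.AlgebraicGeometry.Modules.Annihilator
import Literature.AlgebraicGeometry.Modules.IdealSheafNoetherian
import Literature.AlgebraicGeometry.Morphisms.UnitIsoOver

/-!
# The unit bound of a cover which is an isomorphism over an open: the ALGEBRAIC case (GW II 24.105 (I))

Helper file toward row b03 / crux `AnchorTransport.VariationalHodge` (stmt-HodgeConjecture-1076), line
padic-disc-transport, STUB P (`…_of_grothendieckExistence` rungs), continuing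
`…AnchorTransportVariationalHodgePadicGrothendieckExistenceProper`: there, Grothendieck's existence
theorem for a PROPER scheme was reduced to the uniform unit bound of Görtz–Wedhorn II Lemma 24.105.
The printed proof of that lemma has two steps: (I) the case where the base is complete, so that the
formal module IS the completion `(F₀/aⁿ⁺¹F₀)_n` of a coherent module `F₀`; (II) reduction of the
general case to (I) by the flat base change `Spec B̂ → Spec B`. This file proves step (I) on the
tree's carriers, for any proper `ρ : X' → X` which is an isomorphism over an open `D ⊆ X`
(`IsIso (ρ ∣_ D)`) and any coherent `F₀`:

* `isKilledBy_pow_vanishingIdeal_kernel_cokernel_unit` — the unit `θ : F₀ → ρ_*ρ^*F₀` has kernel and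
  cokernel killed by a power of the vanishing ideal sheaf `𝒥` of `X ∖ D` (they are coherent and
  vanish on `D`, where the unit is an isomorphism: `Morphisms/UnitIsoOver`; supports and powers:
  `Modules/Annihilator`);
* `unit_cmplObj_fac` — the unit of `F₀/aⁿ⁺¹F₀` factors as `θ̄_n : F₀/aⁿ⁺¹ → (ρ_*ρ^*F₀)/aⁿ⁺¹`
  followed by the push–pull comparison `w_n : (ρ_*𝒢')/aⁿ⁺¹ → ρ_*(𝒢'/aⁿ⁺¹) ≅ ρ_*ρ^*(F₀/aⁿ⁺¹)`
  (`𝒢' = ρ^*F₀`), an `a`-power isogeny uniformly in `n` (theorem on formal functions,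
  `…AlgebraizePushforwardComparison`);
* `exists_unitBound_cmplObj` — **hence there are `c, d` with: for every `n`, the unit of
  `F₀/aⁿ⁺¹F₀` has kernel and cokernel killed by `(a)ᶜ·𝒥ᵈ`** (`Modules/KilledByTransfer`).

Step (II) (arbitrary coherent formal towers, via `Spec B̂ → Spec B`) is NOT done here.

HONEST FRAMING: research route conditional on HC_CM; not a corollary; Q11.4-sentence-2 already
refuted in dim ≥ 3. Nothing here bears on `HC_CM`; no case of the Hodge conjecture is proved.

References: GortzWedhorn2023 (II: Lemma 24.105 and its proof, Construction 24.104 (3), pp. 573–574;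
Prop. 24.78); StacksProject (Tag 088B, 088C).
-/

set_option linter.dupNamespace false

noncomputable section

-- Summit.HodgeConjecture.HodgeConjecture.… repeats the summit name by the D-0017 layout (Sub = Summit).

-- `TopCat.Presheaf`/`Scheme.Modules` are not reducible (as in Mathlib's `AlgebraicGeometry/Modules`).
set_option backward.isDefEq.respectTransparency false

open CategoryTheory CategoryTheory.Limits AlgebraicGeometry TopologicalSpace Opposite
open Literature.AlgebraicGeometry.Modules Literature.AlgebraicGeometry.Morphisms
open Literature.AlgebraicGeometry.Motives

universe u

namespace Summit.HodgeConjecture.HodgeConjecture.Theorems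

namespace GrothendieckExistenceProper

open FormalVectorBundlesAlgebraize

section Algebraic

variable {X' X : Scheme.{u}} (ρ : X' ⟶ X) [IsProper ρ] [IsLocallyNoetherian X] [CompactSpace X]
  (a : Γ(X, ⊤)) (D : X.Opens) [IsIso (ρ ∣_ D)]

omit [IsProper ρ] [IsLocallyNoetherian X] [CompactSpace X] [IsIso (ρ ∣_ D)] in
/-- A principal open `D(g)` of an affine `V`, `g` in the vanishing ideal of `X ∖ D`, lies in `D`. -/
theorem basicOpen_le_of_mem_vanishingIdeal (V : X.affineOpens) {g : Γ(X, V)}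
    (hg : g ∈ (Scheme.IdealSheafData.vanishingIdeal D.compl).ideal V) : X.basicOpen g ≤ D := by
  intro x hx
  by_contra hxD
  have hxZ : x ∈ (Scheme.IdealSheafData.vanishingIdeal D.compl).supportSet := by
    change x ∈ ((Scheme.IdealSheafData.vanishingIdeal D.compl).support : Set X)
    rw [Scheme.IdealSheafData.coe_support_vanishingIdeal]
    exact hxD
  exact ((Scheme.mem_zeroLocus_iff _ _ x).mp
    (Scheme.IdealSheafData.supportSet_subset_zeroLocus _ V hxZ) g hg) hx

/-- **The unit `θ : F₀ → ρ_*ρ^*F₀` of a proper `ρ` which is an isomorphism over `D` has kernel and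
cokernel killed by a power of the vanishing ideal of `X ∖ D`** (`F₀` coherent): kernel and cokernel
are coherent and their sections vanish on every affine open inside `D`, where the unit is bijective
(GW II, proof of Lemma 24.105 step (I): "the support of `𝒦` and `𝒞` are contained in `X ∖ U`, hence
there exist ideals of definition … with `ℐ𝒦 = 0` and `ℐ'𝒞 = 0` (Proposition 24.78)"). -/
theorem isKilledBy_pow_vanishingIdeal_kernel_cokernel_unit (F₀ : X.Modules) (hF₀ : Coh F₀) :
    ∃ d : ℕ, IsKilledBy (Scheme.IdealSheafData.vanishingIdeal D.compl ^ d)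
        (kernel ((Scheme.Modules.pullbackPushforwardAdjunction ρ).unit.app F₀)) ∧
      IsKilledBy (Scheme.IdealSheafData.vanishingIdeal D.compl ^ d)
        (cokernel ((Scheme.Modules.pullbackPushforwardAdjunction ρ).unit.app F₀)) := by
  classical
  haveI : IsLocallyNoetherian X' := LocallyOfFiniteType.isLocallyNoetherian ρ
  haveI : CompactSpace X' := QuasiCompact.compactSpace_of_compactSpace ρ
  set θ := (Scheme.Modules.pullbackPushforwardAdjunction ρ).unit.app F₀ with hθ
  have hT : Coh ((Scheme.Modules.pullback ρ ⋙ Scheme.Modules.pushforward ρ).obj F₀) :=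
    coh_pushforward_of_isProper ρ (coh_pullback ρ F₀ hF₀)
  have hK : Coh (kernel θ) := Coh.kernel θ hF₀ hT
  have hC : Coh (cokernel θ) := Coh.cokernel θ hF₀ hT
  -- sections of kernel and cokernel vanish on affine opens inside `D`
  have hKvan : ∀ ⦃D' : X.Opens⦄, IsAffineOpen D' → D' ≤ D → ∀ k : Γ(kernel θ, D'), k = 0 := by
    intro D' hD' hle k
    apply kernel_ι_app_injective θ D'
    rw [map_zero]
    exact (unit_app_bijective_of_le ρ F₀ hF₀.loc hD' hle).1
      ((app_kernel_ι_app θ D' k).trans (map_zero _).symm)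
  have hCvan : ∀ ⦃D' : X.Opens⦄, IsAffineOpen D' → D' ≤ D → ∀ q : Γ(cokernel θ, D'), q = 0 := by
    intro D' hD' hle q
    refine section_eq_zero_of_locally (cokernel θ) q fun x hx => ?_
    obtain ⟨W, hWD', hxW, y, hy⟩ := Scheme.Modules.exists_app_eq_of_epi (cokernel.π θ) D' q x hx
    obtain ⟨W', hW', hxW', hW'le⟩ := Opens.isBasis_iff_nbhd.mp X.isBasis_affineOpens hxW
    refine ⟨W', hW'le.trans hWD', hxW', ?_⟩
    obtain ⟨z, hz⟩ := (unit_app_bijective_of_le ρ F₀ hF₀.loc hW' ((hW'le.trans hWD').trans hle)).2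
      (((Scheme.Modules.pullback ρ ⋙ Scheme.Modules.pushforward ρ).obj F₀).presheaf.map
        (homOfLE hW'le).op y)
    rw [map_eq_map (cokernel θ) _ ((homOfLE hWD').op ≫ (homOfLE hW'le).op), ← map_map, ← hy,
      ← Scheme.Modules.Hom.app_map_apply, ← hz, ← CategoryTheory.comp_apply,
      ← Scheme.Modules.Hom.comp_app, cokernel.condition, Scheme.Modules.Hom.zero_app]
    rfl
  -- a finite affine cover, and the principal opens `D(g)`, `g ∈ 𝒥(V_k)`, lie in `D`
  obtain ⟨t, ht⟩ := exists_finite_affineOpens_iSup_eq_top (X := X)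
  obtain ⟨d₁, hd₁⟩ := exists_isKilledBy_sup_pow (⊥ : X.IdealSheafData) hK.loc hK.ft
    (fun V : t => (V : X.affineOpens)) ht (isKilledBy_bot _) (I := Scheme.IdealSheafData.vanishingIdeal D.compl) fun k g hg m =>
      hKvan ((k : X.affineOpens).2.basicOpen g) (basicOpen_le_of_mem_vanishingIdeal D _ hg) _
  obtain ⟨d₂, hd₂⟩ := exists_isKilledBy_sup_pow (⊥ : X.IdealSheafData) hC.loc hC.ft
    (fun V : t => (V : X.affineOpens)) ht (isKilledBy_bot _) (I := Scheme.IdealSheafData.vanishingIdeal D.compl) fun k g hg m =>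
      hCvan ((k : X.affineOpens).2.basicOpen g) (basicOpen_le_of_mem_vanishingIdeal D _ hg) _
  rw [bot_sup_eq] at hd₁ hd₂
  -- higher powers of an ideal sheaf are smaller (`pow_le_pow_of_le_one` in the ordered semiring
  -- of ideal sheaves, as in `Resolution.IdealSheafData.pow_le_pow_right`)
  exact ⟨d₁ + d₂, IsKilledBy.anti (pow_le_pow_of_le_one bot_le le_top (Nat.le_add_right d₁ d₂)) hd₁,
    IsKilledBy.anti (pow_le_pow_of_le_one bot_le le_top (Nat.le_add_left d₂ d₁)) hd₂⟩

omit [IsProper ρ] [IsLocallyNoetherian X] [CompactSpace X] [IsIso (ρ ∣_ D)] in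
/-- **Factorization of the unit of `F₀/aⁿ⁺¹F₀`** through `θ̄_n : F₀/aⁿ⁺¹ → (ρ_*ρ^*F₀)/aⁿ⁺¹`
(induced by the unit `θ` of `F₀`) and the push–pull comparison
`(ρ_*𝒢')/aⁿ⁺¹ → ρ_*(𝒢'/aⁿ⁺¹) ≅ ρ_*ρ^*(F₀/aⁿ⁺¹)`, `𝒢' = ρ^*F₀` (naturality of the unit, `ρ^*`
preserves cokernels; GW II Construction 24.104 (3)). -/
theorem unit_cmplObj_fac (F₀ : X.Modules) (n : ℕ)
    (v : cmplTower a ((Scheme.Modules.pushforward ρ).obj ((Scheme.Modules.pullback ρ).obj F₀)) ⟶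
      cmplTower (ρ.appTop a) ((Scheme.Modules.pullback ρ).obj F₀) ⋙ Scheme.Modules.pushforward ρ)
    (hv : ∀ n : ℕ, cmplπ a ((Scheme.Modules.pushforward ρ).obj ((Scheme.Modules.pullback ρ).obj F₀)) n ≫
      v.app ⟨n⟩ = (Scheme.Modules.pushforward ρ).map
        (cmplπ (ρ.appTop a) ((Scheme.Modules.pullback ρ).obj F₀) n)) :
    (Scheme.Modules.pullbackPushforwardAdjunction ρ).unit.app (cmplObj a F₀ n) =
      cmplMapApp a ((Scheme.Modules.pullbackPushforwardAdjunction ρ).unit.app F₀) n ≫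
        v.app ⟨n⟩ ≫ (Scheme.Modules.pushforward ρ).map (pullbackCmplObjIso ρ a F₀ n).inv := by
  have h1 : cmplπ a F₀ n ≫ (Scheme.Modules.pullbackPushforwardAdjunction ρ).unit.app (cmplObj a F₀ n) =
      (Scheme.Modules.pullbackPushforwardAdjunction ρ).unit.app F₀ ≫
        (Scheme.Modules.pushforward ρ).map ((Scheme.Modules.pullback ρ).map (cmplπ a F₀ n)) :=
    (Scheme.Modules.pullbackPushforwardAdjunction ρ).unit.naturality (cmplπ a F₀ n)
  have h2 : (Scheme.Modules.pullback ρ).map (cmplπ a F₀ n) =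
      cmplπ (ρ.appTop a) ((Scheme.Modules.pullback ρ).obj F₀) n ≫ (pullbackCmplObjIso ρ a F₀ n).inv := by
    rw [← pullback_map_cmplπ_pullbackCmplObjIso_hom, Category.assoc, Iso.hom_inv_id, Category.comp_id]
  rw [← cancel_epi (cmplπ a F₀ n), h1, h2, Functor.map_comp, ← hv n, ← Category.assoc (cmplπ a F₀ n),
    cmplπ_cmplMapApp]
  simp only [Category.assoc]
  rfl

omit [IsProper ρ] [IsLocallyNoetherian X] [CompactSpace X] [IsIso (ρ ∣_ D)] in
/-- `𝒶ᶜ·𝒥ᵉ ≤ 𝒶ᶜ·𝒥ᵈ` for `d ≤ e`. -/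
theorem mul_pow_le_mul_pow (I J : X.IdealSheafData) (c : ℕ) {d e : ℕ} (h : d ≤ e) :
    I ^ c * J ^ e ≤ I ^ c * J ^ d := by
  refine Scheme.IdealSheafData.le_def.mpr fun U => ?_
  simp only [Scheme.IdealSheafData.ideal_mul, Scheme.IdealSheafData.ideal_pow, Pi.mul_apply,
    Pi.pow_apply]
  exact Ideal.mul_mono_right (Ideal.pow_le_pow_right h)

/-- **GW II Lemma 24.105, step (I) (the algebraic case), on the tree's carriers.** Let `ρ : X' → X`
be proper, `X` noetherian, and an isomorphism over the open `D ⊆ X`; let `a ∈ Γ(X, 𝒪_X)` and `F₀` a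
coherent `𝒪_X`-module. Then there are `c, d` such that for EVERY `n` the unit
`F₀/aⁿ⁺¹F₀ → ρ_*ρ^*(F₀/aⁿ⁺¹F₀)` has kernel and cokernel killed by `(a)ᶜ·𝒥ᵈ`, `𝒥` the vanishing ideal
sheaf of `X ∖ D`: the unit factors as `θ̄_n` (kernel killed by `𝒥²ᵈ`, cokernel by `𝒥ᵈ`,
`Modules/KilledByTransfer`) followed by the push–pull comparison, an `a`-power isogeny uniformly in `n`
(theorem on formal functions for `ρ`, `…AlgebraizePushforwardComparison`). -/
theorem exists_unitBound_cmplObj (F₀ : X.Modules) (hF₀ : Coh F₀) :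
    ∃ c d : ℕ, ∀ n : ℕ,
      IsKilledBy (Scheme.IdealSheafData.ofIdealTop (Ideal.span {a}) ^ c *
          Scheme.IdealSheafData.vanishingIdeal D.compl ^ d)
        (kernel ((Scheme.Modules.pullbackPushforwardAdjunction ρ).unit.app (cmplObj a F₀ n))) ∧
      IsKilledBy (Scheme.IdealSheafData.ofIdealTop (Ideal.span {a}) ^ c *
          Scheme.IdealSheafData.vanishingIdeal D.compl ^ d)
        (cokernel ((Scheme.Modules.pullbackPushforwardAdjunction ρ).unit.app (cmplObj a F₀ n))) := by
  haveI : IsLocallyNoetherian X' := LocallyOfFiniteType.isLocallyNoetherian ρ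
  haveI : CompactSpace X' := QuasiCompact.compactSpace_of_compactSpace ρ
  obtain ⟨d, hkθ, hcθ⟩ := isKilledBy_pow_vanishingIdeal_kernel_cokernel_unit ρ D F₀ hF₀
  have hG' : Coh ((Scheme.Modules.pullback ρ).obj F₀) := coh_pullback ρ F₀ hF₀
  obtain ⟨v, hv⟩ := exists_pushforwardCmplComparison ρ a ((Scheme.Modules.pullback ρ).obj F₀)
  obtain ⟨ck, hck⟩ := pushforwardCmplComparison_kernel_torsion ρ a hG' v hv
  obtain ⟨cc, hcc⟩ := pushforwardCmplComparison_cokernel_torsion ρ a hG' v hv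
  refine ⟨ck + cc, d + d, fun n => ?_⟩
  -- the second leg `w_n = v_n ≫ ρ_*(≅)` is an `a^(ck+cc)`-isogeny
  let ε : ∀ T : X.Modules, T ⟶ T := fun T => globalScalar T (a ^ (ck + cc))
  have hε : ∀ {T T' : X.Modules} (g : T ⟶ T'), ε T ≫ g = g ≫ ε T' := fun g => globalScalar_comp g _
  have hwk : kernel.ι (v.app ⟨n⟩ ≫ (Scheme.Modules.pushforward ρ).map (pullbackCmplObjIso ρ a F₀ n).inv) ≫
      globalScalar ((cmplTower a ((Scheme.Modules.pushforward ρ).obj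
        ((Scheme.Modules.pullback ρ).obj F₀))).obj ⟨n⟩) (a ^ (ck + cc)) = 0 := by
    refine kernel_ι_of_kerBound (a ^ (ck + cc)) _ fun z hz => ?_
    exact kerBound_comp_mono ε (v.app ⟨n⟩) _
      (kerBound_of_kernel_ι (a ^ (ck + cc)) (v.app ⟨n⟩)
        (kernel_ι_pow_of_le a (v.app ⟨n⟩) (Nat.le_add_right ck cc) (hck n))) z hz
  have hwc : globalScalar ((Scheme.Modules.pullback ρ ⋙ Scheme.Modules.pushforward ρ).obj (cmplObj a F₀ n))
        (a ^ (ck + cc)) ≫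
      cokernel.π (v.app ⟨n⟩ ≫ (Scheme.Modules.pushforward ρ).map (pullbackCmplObjIso ρ a F₀ n).inv) = 0 := by
    refine cokernel_π_of_cokerBound (a ^ (ck + cc)) _ fun q hq => ?_
    exact cokerBound_comp_epi ε hε (v.app ⟨n⟩) _
      (cokerBound_of_cokernel_π (a ^ (ck + cc)) (v.app ⟨n⟩)
        (pow_cokernel_π_of_le a (v.app ⟨n⟩) (Nat.le_add_left cc ck) (hcc n))) q hq
  rw [unit_cmplObj_fac ρ a F₀ n v hv]
  refine ⟨?_, ?_⟩
  · have hk := isKilledBy_mul_kernel_comp a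
      (cmplMapApp a ((Scheme.Modules.pullbackPushforwardAdjunction ρ).unit.app F₀) n) _
      (isKilledBy_mul_kernel_cmplMapApp a _ n hkθ hcθ) hwk
    rwa [← pow_add] at hk
  · exact IsKilledBy.anti (mul_pow_le_mul_pow _ _ _ (Nat.le_add_right d d))
      (isKilledBy_mul_cokernel_comp a
        (cmplMapApp a ((Scheme.Modules.pullbackPushforwardAdjunction ρ).unit.app F₀) n) _
        (isKilledBy_cokernel_cmplMapApp a _ n hcθ) hwc)

end Algebraic

end GrothendieckExistenceProper

end Summit.HodgeConjecture.HodgeConjecture.Theorems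

end
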